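import Summits.RiemannHypothesis.RiemannHypothesis.Theses.LiTailLaguerre
import Summits.RiemannHypothesis.RiemannHypothesis.Theorems.LiTailContourCoWeight
import Summits.RiemannHypothesis.RiemannHypothesis.Theorems.LiTailContourIdentity
import Summits.RiemannHypothesis.RiemannHypothesis.Theorems.LiPrimeEchoHorizontalEdges
import Literature.NumberTheory.LFunctions.EquivalentsKeiperLiProofs
import HarnessLib

/-!
# RiemannHypothesis / LiTailLaguerre — crux K1′ `LiTailContour`: the half-strip contour identity for the Li zero TAIL (RH-FREE)

RH-FREE [rh-li-eng g5; binder K1′ of route `Theses/LiTailLaguerre.lean`, rung «Li TAIL–LAGUERRE LAW» L-P(P1-tail), cell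
`pub/rh-li`, dossier `theory/route/r7`], item `LiTailContour` (stmt-RiemannHypothesis-19703): for `n ≥ 1` and a good height
`T ≥ 1`,

  `liZeroTail n T = liPolarTail n T + liGammaTail n T − liPrimeTail n T + liHorizTail n T`.

Proof: the finite half-strip identity at good heights `T < Y` (part 2, `TailContour.tail_window_contour` +
`tail_rightEdge_split`) and the limit `Y → ∞` ALONG GOOD HEIGHTS `Y_k ∈ [k + …, k + … + 1]` (MV Lemma 12.2,
`ExplicitPsi.exists_goodHeight_all`): the zero side tends to `λ_n − Re Σ_{box T} m(1 − zⁿ) = liZeroTail n T` by the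
Bombieri–Lagarias limit `keiperLiCoeff_eq_zero_sum_holds`; the three right-edge pieces tend to the tails (part 1,
`TailContour.tendsto_pieces`: co-weight `O(n²/y²)`); and the top edge `liHorizTail n Y_k` is
`≤ A_n log²(Y_k + 4)/Y_k → 0` (`|ξ'/ξ| ≤ C log(Y+4)/η` on the segment with `1/η ≤ 2 + log(Y+2)/c₀`, and
`|1 − F_n(x + iY)| ≤ e n/Y`).  Unconditional; nothing here bears on the truth of RH.
-/

noncomputable section

-- D-0017: `Summit.<S>.<S>.…` is the designed namespace of a single-problem summit.
set_option linter.dupNamespace false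

open Complex MeasureTheory intervalIntegral Set Filter
open scoped Real Interval Topology ArithmeticFunction.vonMangoldt

namespace Summit.RiemannHypothesis.RiemannHypothesis.Theorems.LiTheory

open Literature.NumberTheory.LFunctions

namespace TailContour

open PrimeEdge HorizontalEdges

/-! ### The top edge is small at good heights -/

/-- `|1 − F_n(x + iY)| ≤ e n/Y` for `x ≥ −1/2`, `Y > 0`, `Y² ≥ n`. -/
theorem norm_one_sub_liWeight_le (n : ℕ) {x Y : ℝ} (hx : -(1 / 2 : ℝ) ≤ x) (hY : 0 < Y) (hn : (n : ℝ) ≤ Y ^ 2) :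
    ‖1 - liWeight n (x + Y * I)‖ ≤ n * Real.exp 1 / Y := by
  set s : ℂ := x + Y * I with hs
  have hs0 : s ≠ 0 := fun h ↦ by
    have := congrArg Complex.im h; simp [hs] at this; exact hY.ne' this
  have hgeom := mul_neg_geom_sum (1 - 1 / s) n
  have hz : liWeight n s = (1 - 1 / s) ^ n := rfl
  rw [hz, ← hgeom, norm_mul]
  have h1 : ‖1 - (1 - 1 / s)‖ ≤ 1 / Y := by
    rw [sub_sub_cancel, norm_div, norm_one]
    apply one_div_le_one_div_of_le hY
    have : Y ^ 2 ≤ ‖s‖ ^ 2 := by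
      rw [Complex.sq_norm, Complex.normSq_apply]; simp [hs]; nlinarith [sq_nonneg x]
    nlinarith [norm_nonneg s]
  have hk : ∀ k ∈ Finset.range n, ‖(1 - 1 / s) ^ k‖ ≤ Real.exp 1 := by
    intro k hk
    have hkn : (k : ℝ) ≤ Y ^ 2 := le_trans (by exact_mod_cast (Finset.mem_range.1 hk).le) hn
    have := norm_liWeight_le_exp k hx hY hkn
    simpa [liWeight, hs] using this
  have hsum : ‖∑ i ∈ Finset.range n, (1 - 1 / s) ^ i‖ ≤ n * Real.exp 1 := by
    calc ‖∑ i ∈ Finset.range n, (1 - 1 / s) ^ i‖ ≤ ∑ i ∈ Finset.range n, ‖(1 - 1 / s) ^ i‖ := norm_sum_le _ _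
      _ ≤ ∑ _i ∈ Finset.range n, Real.exp 1 := Finset.sum_le_sum hk
      _ = n * Real.exp 1 := by simp
  calc ‖1 - (1 - 1 / s)‖ * ‖∑ i ∈ Finset.range n, (1 - 1 / s) ^ i‖ ≤ 1 / Y * (n * Real.exp 1) :=
        mul_le_mul h1 hsum (norm_nonneg _) (by positivity)
    _ = n * Real.exp 1 / Y := by ring

/-- **Good heights with a small top edge.**  For `n ≥ 1` there is `A` such that for every `τ ≥ max(2, n)` some
`Y ∈ [τ, τ + 1]` is a good height with `|liHorizTail n Y| ≤ A · log²(Y + 4)/Y`. -/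
theorem exists_good_top (n : ℕ) (hn : 1 ≤ n) :
    ∃ A : ℝ, ∀ τ : ℝ, 2 ≤ τ → (n : ℝ) ≤ τ → ∃ Y : ℝ, τ ≤ Y ∧ Y ≤ τ + 1 ∧ Y ∈ liGoodHeights ∧
      |liHorizTail n Y| ≤ A * Real.log (Y + 4) ^ 2 / Y := by
  obtain ⟨c₀, hc₀, hgh⟩ := ExplicitPsi.exists_goodHeight_all
  obtain ⟨C, hC0, hseg⟩ := exists_norm_logDeriv_riemannXi_le
  obtain ⟨C', hC'0, hP⟩ := horiz_pointwise
  refine ⟨2 * C * n * Real.exp 1 * (2 + 1 / c₀), fun τ hτ2 hτn ↦ ?_⟩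
  obtain ⟨Y, hYl, hYu, η, hη0, hη1, hinv, hsep⟩ := hgh τ (by linarith)
  have hY2 : 2 ≤ Y := hτ2.trans hYl
  have hY0 : 0 < Y := by linarith
  have hYn : (n : ℝ) ≤ Y := hτn.trans hYl
  have hn1 : (1 : ℝ) ≤ n := by exact_mod_cast hn
  have hsqrt : Real.sqrt n ≤ Y := by
    rw [← Real.sqrt_sq hY0.le]
    exact Real.sqrt_le_sqrt (by nlinarith)
  have hYsq : (n : ℝ) ≤ Y ^ 2 := by nlinarith
  have hsep' : ∀ ρ : ℂ, riemannZeta ρ = 0 → 0 < ρ.re → η ≤ |ρ.im - Y| := fun ρ hζ hre ↦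
    (hsep ρ (ZetaZeros.riemannZetaNontrivialZeros.mem_of_re_pos hζ hre)).1
  have hgood : Y ∈ liGoodHeights := (hP n Y η hY2 hsqrt hη0 hη1 hsep').1
  refine ⟨Y, hYl, hYu, hgood, ?_⟩
  -- the segment integral
  have hYabs : 2 ≤ |Y| := by rw [abs_of_pos hY0]; exact hY2
  have hxi := hseg Y η hYabs hη0 hη1 hsep'
  set K : ℝ := C * Real.log (|Y| + 4) / η with hK
  have hK0 : 0 ≤ K := by
    have : 0 ≤ Real.log (|Y| + 4) := Real.log_nonneg (by linarith [abs_nonneg Y]); positivity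
  have hpt : ∀ x ∈ Ι (-(1 / 2 : ℝ)) (3 / 2),
      ‖logDeriv riemannXi (x + Y * I) * (1 - liWeight n (x + Y * I))‖ ≤ K * (n * Real.exp 1 / Y) := by
    intro x hx
    rw [uIoc_of_le (by norm_num)] at hx
    rw [norm_mul]
    exact mul_le_mul (hxi x ⟨hx.1.le, hx.2⟩) (norm_one_sub_liWeight_le n hx.1.le hY0 hYsq) (norm_nonneg _) hK0
  have hI := intervalIntegral.norm_integral_le_of_norm_le_const hpt
  have hlen : |(3 / 2 : ℝ) - -(1 / 2)| = 2 := by norm_num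
  rw [hlen] at hI
  unfold liHorizTail
  rw [abs_mul, abs_of_pos (by positivity : (0 : ℝ) < 1 / Real.pi)]
  have him := Complex.abs_im_le_norm
    (∫ x in (-(1 / 2 : ℝ))..(3 / 2 : ℝ), logDeriv riemannXi (x + Y * I) * (1 - liWeight n (x + Y * I)))
  have hπ : 1 / Real.pi ≤ 1 := by rw [div_le_one Real.pi_pos]; linarith [Real.pi_gt_three]
  -- `K ≤ C log(Y+4) (2 + log(Y+2)/c₀) ≤ C (2 + 1/c₀) log²(Y+4)`
  have hlog4 : 1 ≤ Real.log (Y + 4) := by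
    rw [Real.le_log_iff_exp_le (by linarith)]
    have := Real.exp_one_lt_d9; linarith
  have hlog2 : Real.log (Y + 2) ≤ Real.log (Y + 4) := Real.log_le_log (by linarith) (by linarith)
  have hinv' : 1 / η ≤ (2 + 1 / c₀) * Real.log (Y + 4) := by
    have h1 : Real.log (Y + 2) / c₀ ≤ Real.log (Y + 4) / c₀ := div_le_div_of_nonneg_right hlog2 hc₀.le
    have h2 : Real.log (Y + 4) / c₀ = 1 / c₀ * Real.log (Y + 4) := by ring
    nlinarith [hinv, h1, h2, hlog4, hc₀]
  have hKle : K ≤ C * (2 + 1 / c₀) * Real.log (Y + 4) ^ 2 := by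
    rw [hK, abs_of_pos hY0]
    have hl0 : 0 ≤ Real.log (Y + 4) := by linarith
    calc C * Real.log (Y + 4) / η = C * Real.log (Y + 4) * (1 / η) := by ring
      _ ≤ C * Real.log (Y + 4) * ((2 + 1 / c₀) * Real.log (Y + 4)) :=
          mul_le_mul_of_nonneg_left hinv' (by positivity)
      _ = C * (2 + 1 / c₀) * Real.log (Y + 4) ^ 2 := by ring
  have hne : 0 ≤ n * Real.exp 1 / Y := by positivity
  calc 1 / Real.pi * |(∫ x in (-(1 / 2 : ℝ))..(3 / 2 : ℝ),
          logDeriv riemannXi (x + Y * I) * (1 - liWeight n (x + Y * I))).im|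
      ≤ 1 * (K * (n * Real.exp 1 / Y) * 2) := mul_le_mul hπ (him.trans hI) (abs_nonneg _) zero_le_one
    _ ≤ (C * (2 + 1 / c₀) * Real.log (Y + 4) ^ 2) * (n * Real.exp 1 / Y) * 2 := by
        rw [one_mul]; gcongr
    _ = 2 * C * n * Real.exp 1 * (2 + 1 / c₀) * Real.log (Y + 4) ^ 2 / Y := by ring

/-! ### The limit along good heights -/

/-- `log²(Y + 4)/Y → 0` along any `Y → ∞`. -/
theorem tendsto_log_sq_div {b : ℕ → ℝ} (hb : Tendsto b atTop atTop) (A : ℝ) :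
    Tendsto (fun k ↦ A * Real.log (b k + 4) ^ 2 / b k) atTop (𝓝 0) := by
  have h1 := Real.tendsto_pow_log_div_mul_add_atTop 1 (-4) 2 one_ne_zero
  have h2 : Tendsto (fun k ↦ b k + 4) atTop atTop := tendsto_atTop_add_const_right _ _ hb
  have h3 := h1.comp h2
  have h4 : Tendsto (fun k ↦ A * (Real.log (b k + 4) ^ 2 / (1 * (b k + 4) + -4))) atTop (𝓝 (A * 0)) :=
    h3.const_mul A
  rw [mul_zero] at h4
  refine h4.congr fun k ↦ ?_
  ring

end TailContour

open TailContour PrimeEdge in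
/-- **Crux K1′ `LiTailContour` of route `LiTailLaguerre`** (stmt-RiemannHypothesis-19703; RH-FREE): for `n ≥ 1` and a good
height `T ≥ 1`, `liZeroTail n T = liPolarTail n T + liGammaTail n T − liPrimeTail n T + liHorizTail n T`. -/
theorem liTailContour_eq (n : ℕ) (T : ℝ) (hn : 1 ≤ n) (hT : 1 ≤ T) (hgood : T ∈ liGoodHeights) :
    liZeroTail n T = liPolarTail n T + liGammaTail n T - liPrimeTail n T + liHorizTail n T := by
  obtain ⟨A, hA⟩ := exists_good_top n hn
  -- the sequence of good heights `Y k ∈ [τ k, τ k + 1]`, `τ k = max (T + 1) (max n 2) + k`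
  set τ : ℕ → ℝ := fun k ↦ max (T + 1) (max (n : ℝ) 2) + k with hτ
  have hτ2 : ∀ k, 2 ≤ τ k := fun k ↦ by
    have : (2 : ℝ) ≤ max (T + 1) (max (n : ℝ) 2) := (le_max_right _ _).trans' (le_max_right _ _)
    simp only [hτ]; linarith [Nat.cast_nonneg (α := ℝ) k]
  have hτn : ∀ k, (n : ℝ) ≤ τ k := fun k ↦ by
    have : (n : ℝ) ≤ max (T + 1) (max (n : ℝ) 2) := (le_max_right _ _).trans' (le_max_left _ _)
    simp only [hτ]; linarith [Nat.cast_nonneg (α := ℝ) k]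
  have hτT : ∀ k, T + 1 ≤ τ k := fun k ↦ by
    simp only [hτ]; linarith [le_max_left (T + 1) (max (n : ℝ) 2), Nat.cast_nonneg (α := ℝ) k]
  have hτk : ∀ k : ℕ, (k : ℝ) ≤ τ k := fun k ↦ by
    simp only [hτ]; linarith [hτ2 k, le_max_left (T + 1) (max (n : ℝ) 2),
      show (0:ℝ) ≤ max (T + 1) (max (n : ℝ) 2) from le_trans (by norm_num) ((le_max_right _ _).trans' (le_max_right _ _))]
  choose Y hYl hYu hYgood hYtop using fun k ↦ hA (τ k) (hτ2 k) (hτn k)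
  have hYT : ∀ k, T < Y k := fun k ↦ by linarith [hτT k, hYl k]
  have hYtend : Tendsto Y atTop atTop :=
    tendsto_atTop_mono (fun k ↦ (hτk k).trans (hYl k)) tendsto_natCast_atTop_atTop
  -- the identity along the sequence
  set box : ℝ → ℂ := fun S ↦ ∑ᶠ ρ ∈ liZeroBox S, (riemannZetaZeroOrder ρ : ℂ) * (1 - (1 - 1 / ρ) ^ n) with hbox
  set P : ℕ → ℝ := fun k ↦ 1 / Real.pi * (∫ y in T..Y k, polarIntegrand n y).re with hP
  set G : ℕ → ℝ := fun k ↦ 1 / Real.pi * (∫ y in T..Y k, gammaIntegrand n y).re with hG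
  set Q : ℕ → ℝ := fun k ↦ 1 / Real.pi * (∫ y in T..Y k, primeIntegrand n y).re with hQ
  have hident : ∀ k, (box (Y k)).re - (box T).re = P k + G k - Q k + liHorizTail n T - liHorizTail n (Y k) := by
    intro k
    have h1 := tail_window_contour n hT (hYT k) hgood (hYgood k)
    have h2 := tail_rightEdge_split n T (Y k)
    simp only [hbox, hP, hG, hQ, polarIntegrand, gammaIntegrand, primeIntegrand]
    rw [h1, h2]
  -- the limits
  have hBL := Literature.NumberTheory.LFunctions.keiperLiCoeff_eq_zero_sum_holds n hn
  have hLHS : Tendsto (fun k ↦ (box (Y k)).re - (box T).re) atTop (𝓝 (keiperLiCoeff n - (box T).re)) := by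
    have h1 : Tendsto (fun k ↦ (box (Y k)).re) atTop (𝓝 ((keiperLiCoeff n : ℂ).re)) :=
      (Complex.continuous_re.tendsto _).comp (hBL.comp hYtend)
    rw [Complex.ofReal_re] at h1
    exact h1.sub_const _
  obtain ⟨hPt, hGt, hQt⟩ := tendsto_pieces n hT hYtend
  have htop : Tendsto (fun k ↦ liHorizTail n (Y k)) atTop (𝓝 0) := by
    refine squeeze_zero_norm (fun k ↦ ?_) (tendsto_log_sq_div hYtend A)
    rw [Real.norm_eq_abs]
    exact hYtop k
  have hRHS : Tendsto (fun k ↦ P k + G k - Q k + liHorizTail n T - liHorizTail n (Y k)) atTop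
      (𝓝 (liPolarTail n T + liGammaTail n T - liPrimeTail n T + liHorizTail n T - 0)) :=
    (((hPt.add hGt).sub hQt).add_const _).sub htop
  rw [sub_zero] at hRHS
  have hEq : keiperLiCoeff n - (box T).re = liPolarTail n T + liGammaTail n T - liPrimeTail n T + liHorizTail n T :=
    tendsto_nhds_unique (hLHS.congr hident) hRHS
  unfold liZeroTail
  exact hEq

/-- **Item `LiTailContour` of route `LiTailLaguerre`** (stmt-RiemannHypothesis-19703), closed BY NAME. -/
theorem liTailContour_proof : Summit.RiemannHypothesis.RiemannHypothesis.Theses.LiTailLaguerre.LiTailContour :=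
  fun n T hn hT hgood ↦ liTailContour_eq n T hn hT hgood

end Summit.RiemannHypothesis.RiemannHypothesis.Theorems.LiTheory

end
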